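import Summits.ResolutionOfSingularities.ResolutionOfSingularities.Theorems.FrobeniusLadderFRationalResolutionPushoutDegreeGroup
import Mathlib.GroupTheory.QuotientGroup.Basic
import HarnessLib

/-!
# Crux `FrobeniusLadder.FRationalResolution` (stmt-ResolutionOfSingularities-15317), line `redirect`,
# stub `stub_diagonalizableQuotientResolution` — item (F2c): the PUSHOUT grading group `A' = (A × ℤ/(nd))/⟨(b, −d)⟩` in which a
# degree `b` of order `n` becomes `d`-divisible (`ι b = d • a`), with `A ↪ A'`, and a COMPLEMENT of `⟨a⟩` from a character
# `s : A →+ ℤ/(nd)` with `s b = d`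

For the multi-root recipe (MEMO-15317-leafhand2-g22): regrade by `ι : A ↪ A'` (`…RegradeChart`), adjoin `w^d = u` with
`deg u = ι b = d • a` (`…RootAdjoinRechart`), split off along a complement (`…SubchartOfSummand`).

* `exists_pushout_order` — `…PushoutDegreeGroup.exists_pushout` with, in addition, the ORDER information `t • a = 0 ⇒ n d ∣ t`
  (needed to compare unit-degree subgroups before and after a root adjunction): for `b ∈ A` of order `n ≥ 1`, `d ≥ 1` and
  `s : A →+ ZMod (n d)` with `s b = d`: a finite abelian group `A'`,
  an injective `ι : A →+ A'`, `a ∈ A'` with `d • a = ι b`, a subgroup `C ≤ A'` with `⟨a⟩ ⊔ C = ⊤`, `⟨a⟩ ⊓ C = ⊥` (the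
  graph of `−s`), and the decomposition `ι i = c + (s i) • a` along it.

Honest label: helper toward ONE leaf stub; no stub, crux or summit closed. No definitions, no named facts, no sorry. [folklore]
-/

noncomputable section

-- single-problem summit: the doubled namespace component is forced
set_option linter.dupNamespace false

namespace Summit.ResolutionOfSingularities.ResolutionOfSingularities.Theorems.FRationalResolution.PushoutDegreeGroupOrder

/-- **The pushout degree group.** `A` finite abelian, `b ∈ A` of order `n`, `d ≥ 1`, `s : A →+ ZMod (n d)` with `s b = d`. Then
there are a finite abelian group `A'`, an injective `ι : A →+ A'`, an element `a` with `d • a = ι b`, and a complement `C` of the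
cyclic subgroup `⟨a⟩` (`⟨a⟩ ⊔ C = ⊤`, `⟨a⟩ ⊓ C = ⊥`) with `ι i ∈ C + (s i) • a`; namely `A' = (A × ZMod (n d))/⟨(b, −d)⟩`,
`a = [(0, 1)]`, `C = {[(i, −s i)]}`. [folklore] -/
theorem exists_pushout_order {A : Type} [AddCommGroup A] [Finite A] (b : A) (d : ℕ) [NeZero d]
    (s : A →+ ZMod (addOrderOf b * d)) (hs : s b = (d : ZMod (addOrderOf b * d))) :
    ∃ (A' : Type) (_ : AddCommGroup A') (_ : Finite A') (ι : A →+ A') (a : A') (C : AddSubgroup A'),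
      Function.Injective ι ∧ d • a = ι b ∧
      AddSubgroup.zmultiples a ⊔ C = ⊤ ∧ AddSubgroup.zmultiples a ⊓ C = ⊥ ∧
      (∀ i : A, ∃ c ∈ C, ι i = c + (s i).val • a) ∧ (∀ t : ℕ, t • a = 0 → addOrderOf b * d ∣ t) := by
  classical
  have hn0 : 0 < addOrderOf b := (isOfFinAddOrder_of_finite b).addOrderOf_pos
  haveI : NeZero (addOrderOf b * d) := ⟨Nat.mul_ne_zero hn0.ne' (NeZero.ne d)⟩
  let K : AddSubgroup (A × ZMod (addOrderOf b * d)) := AddSubgroup.zmultiples (b, -(d : ZMod (addOrderOf b * d)))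
  let A' := (A × ZMod (addOrderOf b * d)) ⧸ K
  let π : A × ZMod (addOrderOf b * d) →+ A' := QuotientAddGroup.mk' K
  let ι : A →+ A' := π.comp (AddMonoidHom.inl A (ZMod (addOrderOf b * d)))
  let a : A' := π (0, 1)
  -- membership in `K`
  have hK : ∀ x : A × ZMod (addOrderOf b * d), x ∈ K ↔ ∃ j : ℤ, j • b = x.1 ∧ -(j • (d : ZMod (addOrderOf b * d))) = x.2 := by
    intro x
    rw [AddSubgroup.mem_zmultiples_iff]
    constructor
    · rintro ⟨j, hj⟩
      refine ⟨j, ?_, ?_⟩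
      · have := congrArg Prod.fst hj; simpa using this
      · have := congrArg Prod.snd hj; simpa [smul_neg] using this
    · rintro ⟨j, h1, h2⟩
      refine ⟨j, Prod.ext ?_ ?_⟩
      · simpa using h1
      · simpa [smul_neg] using h2
  have hπ0 : ∀ x : A × ZMod (addOrderOf b * d), π x = 0 ↔ x ∈ K := fun x => QuotientAddGroup.eq_zero_iff x
  -- `ι` is injective: `(i, 0) ∈ K` forces `j d ≡ 0 (mod n d)`, so `n ∣ j` and `i = j b = 0`
  have hι : Function.Injective ι := by
    rw [injective_iff_map_eq_zero]
    intro i hi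
    have hi' : ((i, (0 : ZMod (addOrderOf b * d))) : A × ZMod (addOrderOf b * d)) ∈ K := (hπ0 _).1 hi
    obtain ⟨j, hj1, hj2⟩ := (hK _).1 hi'
    simp only at hj1 hj2
    rw [neg_eq_zero, zsmul_eq_mul] at hj2
    -- `(j d : ZMod (n d)) = 0` ⇒ `n d ∣ j d` ⇒ `n ∣ j`
    have hdvd : (addOrderOf b : ℤ) ∣ j := by
      have h1 : ((j * d : ℤ) : ZMod (addOrderOf b * d)) = 0 := by push_cast; exact hj2
      rw [ZMod.intCast_zmod_eq_zero_iff_dvd] at h1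
      push_cast at h1
      exact Int.dvd_of_mul_dvd_mul_right (by exact_mod_cast (NeZero.ne d)) h1
    obtain ⟨t, rfl⟩ := hdvd
    rw [← hj1, mul_comm, mul_zsmul, natCast_zsmul, addOrderOf_nsmul_eq_zero, zsmul_zero]
  -- `d • a = ι b`
  have hda : d • a = ι b := by
    show d • π (0, 1) = π (b, 0)
    rw [← map_nsmul, eq_comm, ← sub_eq_zero, ← map_sub, hπ0, hK]
    refine ⟨1, ?_, ?_⟩
    · simp
    · simp
  -- the complement: graph of `−s`
  let σ : A →+ A' := π.comp ((AddMonoidHom.inl A (ZMod (addOrderOf b * d))) - (AddMonoidHom.inr A (ZMod (addOrderOf b * d))).comp s)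
  have hσ : ∀ i, σ i = π (i, -s i) := fun i => by
    simp only [σ, AddMonoidHom.comp_apply, AddMonoidHom.sub_apply, AddMonoidHom.inl_apply, AddMonoidHom.inr_apply,
      Prod.mk_sub_mk, sub_zero, zero_sub]
  let C : AddSubgroup A' := σ.range
  have hdecomp : ∀ (i : A) (m : ZMod (addOrderOf b * d)), π (i, m) = σ i + (m + s i).val • a := by
    intro i m
    rw [hσ, show (m + s i).val • a = π ((0 : A), ((m + s i).val : ZMod (addOrderOf b * d))) by
      rw [ZMod.natCast_zmod_val, ← map_nsmul]; congr 1; ext <;> simp, ← map_add]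
    congr 1
    ext <;> simp
  have hsup : AddSubgroup.zmultiples a ⊔ C = ⊤ := by
    rw [eq_top_iff]
    rintro x -
    obtain ⟨⟨i, m⟩, rfl⟩ := QuotientAddGroup.mk'_surjective K x
    change π (i, m) ∈ _
    rw [hdecomp]
    exact add_mem (AddSubgroup.mem_sup_right ⟨i, rfl⟩)
      (AddSubgroup.mem_sup_left (AddSubgroup.nsmul_mem _ (AddSubgroup.mem_zmultiples a) _))
  have hinf : AddSubgroup.zmultiples a ⊓ C = ⊥ := by
    rw [eq_bot_iff]
    rintro x ⟨hxa, hxC⟩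
    obtain ⟨m, rfl⟩ := AddSubgroup.mem_zmultiples_iff.1 hxa
    obtain ⟨i, hi⟩ := hxC
    rw [hσ] at hi
    -- `π (i, −s i) = m • π (0,1)` ⇒ `(i, −s i − m) ∈ K` ⇒ `i = j b`, `−s i − m = −j d` ⇒ `m = 0 (mod nd)`... ⇒ `m • a = 0`
    have hmem : ((i, -s i - (m : ZMod (addOrderOf b * d))) : A × ZMod (addOrderOf b * d)) ∈ K := by
      rw [← hπ0, show ((i, -s i - (m : ZMod (addOrderOf b * d))) : A × ZMod (addOrderOf b * d)) = (i, -s i) - m • ((0 : A), (1 : ZMod (addOrderOf b * d))) by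
        ext <;> simp, map_sub, map_zsmul, hi, sub_self]
    obtain ⟨j, hj1, hj2⟩ := (hK _).1 hmem
    simp only at hj1 hj2
    have hsi : s i = j • (d : ZMod (addOrderOf b * d)) := by rw [← hj1, map_zsmul, hs]
    have hm0 : (m : ZMod (addOrderOf b * d)) = 0 := by
      have h2 := hj2
      rw [hsi, zsmul_eq_mul] at h2
      linear_combination h2
    rw [AddSubgroup.mem_bot, show m • a = π ((0 : A), (m : ZMod (addOrderOf b * d))) by rw [← map_zsmul]; congr 1; ext <;> simp, hm0,
      show ((0 : A), (0 : ZMod (addOrderOf b * d))) = 0 from rfl, map_zero]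
  haveI : Finite A' := Quotient.finite _
  -- order information: `t • a = 0 ⇒ n d ∣ t`
  have hord : ∀ t : ℕ, t • a = 0 → addOrderOf b * d ∣ t := by
    intro t ht
    have hmem : (((0 : A), (t : ZMod (addOrderOf b * d))) : A × ZMod (addOrderOf b * d)) ∈ K := by
      rw [← hπ0, show (((0 : A), (t : ZMod (addOrderOf b * d))) : A × ZMod (addOrderOf b * d)) =
        t • ((0 : A), (1 : ZMod (addOrderOf b * d))) by ext <;> simp, map_nsmul]
      exact ht
    obtain ⟨j, hj1, hj2⟩ := (hK _).1 hmem
    simp only at hj1 hj2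
    -- `j • b = 0` ⇒ `n ∣ j` ⇒ `j • d = 0` in `ZMod (n d)` ⇒ `t = 0` there
    have hnj : (addOrderOf b : ℤ) ∣ j := addOrderOf_dvd_iff_zsmul_eq_zero.2 hj1
    obtain ⟨j', rfl⟩ := hnj
    have ht0 : (t : ZMod (addOrderOf b * d)) = 0 := by
      rw [← hj2, neg_eq_zero, zsmul_eq_mul, Int.cast_mul, Int.cast_natCast]
      have hnd : ((addOrderOf b : ZMod (addOrderOf b * d))) * (d : ZMod (addOrderOf b * d)) = 0 := by
        rw [← Nat.cast_mul, ZMod.natCast_self]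
      calc (addOrderOf b : ZMod (addOrderOf b * d)) * ((j' : ℤ) : ZMod (addOrderOf b * d)) * (d : ZMod (addOrderOf b * d))
          = ((addOrderOf b : ZMod (addOrderOf b * d)) * d) * ((j' : ℤ) : ZMod (addOrderOf b * d)) := by ring
        _ = 0 := by rw [hnd, zero_mul]
    exact (ZMod.natCast_eq_zero_iff t _).1 ht0
  refine ⟨A', inferInstance, inferInstance, ι, a, C, hι, hda, hsup, hinf, fun i => ⟨σ i, ⟨i, rfl⟩, ?_⟩, hord⟩
  have h := hdecomp i 0
  rw [zero_add] at h
  exact h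

end Summit.ResolutionOfSingularities.ResolutionOfSingularities.Theorems.FRationalResolution.PushoutDegreeGroupOrder

end
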